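import Mathlib
import Summits.Ventures.PercRepro2.Defs
import Summits.Ventures.PercRepro2.Graph
import Summits.Ventures.PercRepro2.Events
import Summits.Ventures.PercRepro2.Harris
import Summits.Ventures.PercRepro2.BHKEvents
import Summits.Ventures.PercRepro2.BHKAvoid

/-!
# Row 2′MM0, sharper form (MM0⁻): the sector split and the sector-0 theorem
(blind cell PercRepro2, night-1 g2; `proofs/NIGHT1-MM0.md`)

Six vertices `s t b u w v` of a finite weighted graph `H`; `{u, w}` is the free edge (its absence
from `H` is never used below). Events (all in `H`):

* `RT = {s ↮ t}`, `Y = {b ∈ C(s)}` (the marker `y`), `Z₀ = {v ∈ C(t)}`;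
* `hits = {u ∈ C(t)} ∪ {w ∈ C(t)}` — the cluster of `t` meets the free pair;
* `bridge = {s ↔ u, t ↔ w} ∪ {s ↔ w, t ↔ u}` — the open edge `uw` would connect `s` to `t`;
* `gate = RT ∖ bridge = {s ↮ t in H + uw}`, `Zev = {v ↔ t in H + uw}
  = Z₀ ∪ {v ↔ u, t ↔ w} ∪ {v ↔ w, t ↔ u}`.

With `ȳ = P(Y | RT)` and `c = P(Z₀ | RT)`, the statement (MM0⁻) of record (the lead's
killed-mass form of night-1's one-marker root-merge monotonicity, INBOX 2026-08-23T23:12:20Z)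
is `E[(y − ȳ)(1_Zev − c); gate] ≤ 0`; multiplied by `P(RT)²` it is the cubic mass inequality
`mm0minusForm ≤ 0` below.

* `gate_inter_hits_compl`: the gate is the disjoint union of sector 0 `A₀ = {C(t) avoids s, u, w}`
  and sector 1 `gate ∩ hits`, and on sector 0 `Zev = Z₀` (`Zev_inter_avoid`);
* `sector0_nonpos` (THEOREM): the sector-0 part `E[(y − ȳ)(1_{Z₀} − c); A₀] ≤ 0`, from three landed
  BHK06 inequalities — cross-cluster with `C(t)` avoiding `{s, u, w}` (`bhk_cross_cluster_avoid`),
  cross-cluster `Y` against `hits` (`bhk_cross_cluster`), same-cluster positive association of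
  `C(t)` given `t ↮ s` for `Z₀` and `hits` (`bhk_same_cluster_events`) — and the identity
  `A · sector0 = (a·Y_A − A·Y_R)(a·Z_A − A·Z_R) + a²(A·YZ_A − Y_A·Z_A)`;
* `mm0minusForm_eq`: the exact split `mm0minusForm = sector0Form + sector1Form`;
* `mm0minus_of_sector1`: (MM0⁻) follows from the sector-1 statement (S1)
  `E[(y − ȳ)(1_Zev − c); gate ∩ hits] ≤ 0`, the open content of row 2′MM0 (exact census at `n = 6`:
  0 / 5,568 instances; its covariance half `Cov(y, 1_Zev | gate ∩ hits) ≤ 0` alone FAILS 158 / 5,568,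
  so (S1) is not a corollary of the BHK toolbox — the shift product `(E[y | sec1] − ȳ)(P(Zev | sec1) − c)`
  must carry it).
-/

namespace Summit.Ventures.PercRepro2
namespace MM0Sector

variable {V : Type*} {E : Type*} [Fintype E] [DecidableEq E] [Fintype V] [DecidableEq V]
  {R : Type*} [CommRing R] [LinearOrder R] [IsStrictOrderedRing R]

/-! ## The events -/

section Events

variable (ends : E → Sym2 V)

/-- `hits = {u ∈ C(t)} ∪ {w ∈ C(t)}`: the cluster of `t` meets the free pair `{u, w}`. -/
def hits (t u w : V) : Set (Config E) := connEvent ends t u ∪ connEvent ends t w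

/-- `bridge = {s ↔ u, t ↔ w} ∪ {s ↔ w, t ↔ u}`: the edge `uw`, if open, would join `s` to `t`. -/
def bridge (s t u w : V) : Set (Config E) :=
  (connEvent ends s u ∩ connEvent ends t w) ∪ (connEvent ends s w ∩ connEvent ends t u)

/-- `gate = {s ↮ t} ∖ bridge = {s ↮ t in H + uw}`. -/
def gate (s t u w : V) : Set (Config E) := (connEvent ends s t)ᶜ ∩ (bridge ends s t u w)ᶜ

/-- `Zev = {v ↔ t in H + uw} = {v ↔ t} ∪ {v ↔ u, t ↔ w} ∪ {v ↔ w, t ↔ u}`. -/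
def Zev (t u w v : V) : Set (Config E) :=
  connEvent ends t v ∪ (connEvent ends v u ∩ connEvent ends t w) ∪
    (connEvent ends v w ∩ connEvent ends t u)

omit [Fintype E] [DecidableEq E] [Fintype V] in
/-- Sector 0, `{C(t) avoids s, u, w}`, is `{s ↮ t} ∩ hitsᶜ`. -/
lemma avoidAll_tsuw (s t u w : V) :
    avoidAll ends t {s, u, w} = (connEvent ends s t)ᶜ ∩ (hits ends t u w)ᶜ := by
  ext ω
  simp only [avoidAll, Set.mem_setOf_eq, Finset.mem_insert, Finset.mem_singleton, forall_eq_or_imp,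
    forall_eq, Set.mem_inter_iff, Set.mem_compl_iff, hits, Set.mem_union, mem_connEvent, not_or]
  constructor
  · rintro ⟨hs, hu, hw⟩
    exact ⟨fun h => hs (conn_symm h), hu, hw⟩
  · rintro ⟨hs, hu, hw⟩
    exact ⟨fun h => hs (conn_symm h), hu, hw⟩

omit [Fintype E] [DecidableEq E] [Fintype V] in
/-- Off `hits` the bridge is closed: `gate ∩ hitsᶜ` is sector 0. -/
lemma gate_inter_hits_compl (s t u w : V) :
    gate ends s t u w ∩ (hits ends t u w)ᶜ = avoidAll ends t {s, u, w} := by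
  rw [avoidAll_tsuw]
  ext ω
  simp only [gate, bridge, hits, Set.mem_inter_iff, Set.mem_compl_iff, Set.mem_union,
    mem_connEvent, not_or, not_and]
  tauto

omit [Fintype E] [DecidableEq E] [Fintype V] in
/-- On sector 0 the event `Zev` is `{v ↔ t}`. -/
lemma Zev_inter_avoid (s t u w v : V) :
    Zev ends t u w v ∩ avoidAll ends t {s, u, w} = connEvent ends t v ∩ avoidAll ends t {s, u, w} := by
  rw [avoidAll_tsuw]
  ext ω
  simp only [Zev, hits, Set.mem_inter_iff, Set.mem_union, Set.mem_compl_iff, mem_connEvent, not_or]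
  tauto

omit [Fintype E] [DecidableEq E] [Fintype V] [DecidableEq V] in
/-- `{C(t) ∋ v}` is the connection event `{t ↔ v}`. -/
lemma clusterInEvent_mem_eq (x v : V) :
    clusterInEvent ends x {W | v ∈ W} = connEvent ends x v := by
  ext ω
  simp only [mem_clusterInEvent, Set.mem_setOf_eq, cluster, mem_connEvent]

omit [Fintype E] [DecidableEq E] [Fintype V] [DecidableEq V] in
/-- `{C(t) meets {u, w}}` is `hits`. -/
lemma clusterInEvent_hits_eq (t u w : V) :
    clusterInEvent ends t {W | u ∈ W ∨ w ∈ W} = hits ends t u w := by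
  ext ω
  simp only [mem_clusterInEvent, Set.mem_setOf_eq, cluster, hits, Set.mem_union, mem_connEvent]

omit [Fintype E] [DecidableEq E] [Fintype V] [DecidableEq V] in
/-- The family of vertex sets containing `v` is an up-set. -/
lemma isUpperSet_mem (v : V) : IsUpperSet {W : Set V | v ∈ W} := fun _ _ h hW => h hW

omit [Fintype E] [DecidableEq E] [Fintype V] [DecidableEq V] in
/-- The family of vertex sets meeting `{u, w}` is an up-set. -/
lemma isUpperSet_mem_or (u w : V) : IsUpperSet {W : Set V | u ∈ W ∨ w ∈ W} :=
  fun _ _ h hW => hW.elim (fun hu => Or.inl (h hu)) (fun hw => Or.inr (h hw))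

end Events

/-! ## The three sector-0 masses split off `hits` -/

section Split

variable (p : E → R) (ends : E → Sym2 V)

omit [Fintype V] [LinearOrder R] [IsStrictOrderedRing R] in
/-- `P(X ∩ {s ↮ t}) = P(X ∩ {s ↮ t} ∩ hits) + P(X ∩ A₀)` for every event `X`. -/
lemma prob_inter_RT_split (s t u w : V) (X : Set (Config E)) :
    prob p (X ∩ (connEvent ends s t)ᶜ) =
      prob p (X ∩ (connEvent ends s t)ᶜ ∩ hits ends t u w) +
        prob p (X ∩ avoidAll ends t {s, u, w}) := by
  rw [← prob_inter_add_prob_inter_compl p (X ∩ (connEvent ends s t)ᶜ) (hits ends t u w),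
    avoidAll_tsuw, ← Set.inter_assoc]

omit [Fintype V] [LinearOrder R] [IsStrictOrderedRing R] in
/-- `P(X ∩ gate) = P(X ∩ gate ∩ hits) + P(X ∩ A₀)` for every event `X`. -/
lemma prob_inter_gate_split (s t u w : V) (X : Set (Config E)) :
    prob p (X ∩ gate ends s t u w) =
      prob p (X ∩ gate ends s t u w ∩ hits ends t u w) + prob p (X ∩ avoidAll ends t {s, u, w}) := by
  rw [← prob_inter_add_prob_inter_compl p (X ∩ gate ends s t u w) (hits ends t u w),
    Set.inter_assoc X (gate ends s t u w) (hits ends t u w)ᶜ, gate_inter_hits_compl]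

end Split

/-! ## The forms -/

section Forms

variable (p : E → R) (ends : E → Sym2 V) (s t b u w v : V)

/-- `P(RT)² · E[(y − ȳ)(1_{Z₀} − c); A₀]` with `ȳ = P(Y | RT)`, `c = P(Z₀ | RT)`: the sector-0 part. -/
noncomputable def sector0Form : R :=
  prob p (connEvent ends s t)ᶜ ^ 2 *
      prob p (connEvent ends s b ∩ connEvent ends t v ∩ avoidAll ends t {s, u, w})
    - prob p (connEvent ends s t)ᶜ * prob p (connEvent ends s b ∩ (connEvent ends s t)ᶜ) *
      prob p (connEvent ends t v ∩ avoidAll ends t {s, u, w})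
    - prob p (connEvent ends s t)ᶜ * prob p (connEvent ends t v ∩ (connEvent ends s t)ᶜ) *
      prob p (connEvent ends s b ∩ avoidAll ends t {s, u, w})
    + prob p (connEvent ends s b ∩ (connEvent ends s t)ᶜ) *
      prob p (connEvent ends t v ∩ (connEvent ends s t)ᶜ) * prob p (avoidAll ends t {s, u, w})

/-- `P(RT)² · E[(y − ȳ)(1_{Zev} − c); gate ∩ hits]`: the sector-1 part, the statement (S1). -/
noncomputable def sector1Form : R :=
  prob p (connEvent ends s t)ᶜ ^ 2 *
      prob p (connEvent ends s b ∩ Zev ends t u w v ∩ gate ends s t u w ∩ hits ends t u w)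
    - prob p (connEvent ends s t)ᶜ * prob p (connEvent ends s b ∩ (connEvent ends s t)ᶜ) *
      prob p (Zev ends t u w v ∩ gate ends s t u w ∩ hits ends t u w)
    - prob p (connEvent ends s t)ᶜ * prob p (connEvent ends t v ∩ (connEvent ends s t)ᶜ) *
      prob p (connEvent ends s b ∩ gate ends s t u w ∩ hits ends t u w)
    + prob p (connEvent ends s b ∩ (connEvent ends s t)ᶜ) *
      prob p (connEvent ends t v ∩ (connEvent ends s t)ᶜ) *
      prob p (gate ends s t u w ∩ hits ends t u w)

/-- `P(RT)² · E[(y − ȳ)(1_{Zev} − c); gate]`: (MM0⁻) says this is `≤ 0`. -/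
noncomputable def mm0minusForm : R :=
  prob p (connEvent ends s t)ᶜ ^ 2 *
      prob p (connEvent ends s b ∩ Zev ends t u w v ∩ gate ends s t u w)
    - prob p (connEvent ends s t)ᶜ * prob p (connEvent ends s b ∩ (connEvent ends s t)ᶜ) *
      prob p (Zev ends t u w v ∩ gate ends s t u w)
    - prob p (connEvent ends s t)ᶜ * prob p (connEvent ends t v ∩ (connEvent ends s t)ᶜ) *
      prob p (connEvent ends s b ∩ gate ends s t u w)
    + prob p (connEvent ends s b ∩ (connEvent ends s t)ᶜ) *
      prob p (connEvent ends t v ∩ (connEvent ends s t)ᶜ) * prob p (gate ends s t u w)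

omit [Fintype V] [LinearOrder R] [IsStrictOrderedRing R] in
/-- The exact sector split `mm0minusForm = sector0Form + sector1Form`. -/
theorem mm0minusForm_eq :
    mm0minusForm p ends s t b u w v = sector0Form p ends s t b u w v + sector1Form p ends s t b u w v := by
  have h1 := prob_inter_gate_split p ends s t u w (connEvent ends s b ∩ Zev ends t u w v)
  have h2 := prob_inter_gate_split p ends s t u w (Zev ends t u w v)
  have h3 := prob_inter_gate_split p ends s t u w (connEvent ends s b)
  have h4 := prob_inter_gate_split p ends s t u w Set.univ
  rw [Set.inter_assoc (connEvent ends s b) (Zev ends t u w v) (avoidAll ends t {s, u, w}),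
    Zev_inter_avoid, ← Set.inter_assoc (connEvent ends s b) (connEvent ends t v)
      (avoidAll ends t {s, u, w})] at h1
  rw [Zev_inter_avoid] at h2
  simp only [Set.univ_inter] at h4
  unfold mm0minusForm sector0Form sector1Form
  rw [h1, h2, h3, h4]
  ring

end Forms

/-! ## The sector-0 theorem -/

section Sector0

/-- **Sector 0 is nonpositive**: `E[(y − ȳ)(1_{Z₀} − c); C(t) avoids {s, u, w}] ≤ 0`. -/
theorem sector0_nonpos (p : E → R) (hp : IsProbVec p) (ends : E → Sym2 V) (s t b u w v : V) :
    sector0Form p ends s t b u w v ≤ 0 := by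
  classical
  unfold sector0Form
  -- the masses
  set a := prob p (connEvent ends s t)ᶜ with ha
  set A := prob p (avoidAll ends t {s, u, w}) with hA
  set YR := prob p (connEvent ends s b ∩ (connEvent ends s t)ᶜ) with hYR
  set ZR := prob p (connEvent ends t v ∩ (connEvent ends s t)ᶜ) with hZR
  set YA := prob p (connEvent ends s b ∩ avoidAll ends t {s, u, w}) with hYA
  set ZA := prob p (connEvent ends t v ∩ avoidAll ends t {s, u, w}) with hZA
  set YZA := prob p (connEvent ends s b ∩ connEvent ends t v ∩ avoidAll ends t {s, u, w}) with hYZA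
  set HR := prob p (hits ends t u w ∩ (connEvent ends s t)ᶜ) with hHR
  set YHR := prob p (connEvent ends s b ∩ (connEvent ends s t)ᶜ ∩ hits ends t u w) with hYHR
  set ZHR := prob p (connEvent ends t v ∩ (connEvent ends s t)ᶜ ∩ hits ends t u w) with hZHR
  have hRT : (connEvent ends t s)ᶜ = (connEvent ends s t)ᶜ := by rw [connEvent_comm]
  -- (i) cross-cluster BHK with `C(t)` avoiding `{s, u, w}`: `YZA · A ≤ ZA · YA`
  have hi : YZA * A ≤ ZA * YA := by
    have key := bhk_cross_cluster_avoid p hp ends t s (X := {s, u, w}) (by simp)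
      (isUpperSet_mem v) (isUpperSet_mem b)
    rw [clusterInEvent_mem_eq, clusterInEvent_mem_eq] at key
    have e : connEvent ends t v ∩ connEvent ends s b ∩ avoidAll ends t {s, u, w} =
        connEvent ends s b ∩ connEvent ends t v ∩ avoidAll ends t {s, u, w} := by
      rw [Set.inter_comm (connEvent ends t v)]
    rw [e] at key
    exact key
  -- (ii) cross-cluster BHK, `Y` against `hits`: `YHR · a ≤ YR · HR`
  have hii : YHR * a ≤ YR * HR := by
    have key := bhk_cross_cluster p hp ends s t (isUpperSet_mem b) (isUpperSet_mem_or u w)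
    rw [clusterInEvent_mem_eq, clusterInEvent_hits_eq] at key
    have e : connEvent ends s b ∩ hits ends t u w ∩ (connEvent ends s t)ᶜ =
        connEvent ends s b ∩ (connEvent ends s t)ᶜ ∩ hits ends t u w := by
      rw [Set.inter_assoc, Set.inter_comm (hits ends t u w), ← Set.inter_assoc]
    rw [e] at key
    exact key
  -- (iii) same-cluster positive association of `C(t)` given `t ↮ s`: `ZR · HR ≤ ZHR · a`
  have hiii : ZR * HR ≤ ZHR * a := by
    have key := bhk_same_cluster_events p hp ends t s (isUpperSet_mem v) (isUpperSet_mem_or u w)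
    rw [clusterInEvent_mem_eq, clusterInEvent_hits_eq, hRT] at key
    have e : connEvent ends t v ∩ hits ends t u w ∩ (connEvent ends s t)ᶜ =
        connEvent ends t v ∩ (connEvent ends s t)ᶜ ∩ hits ends t u w := by
      rw [Set.inter_assoc, Set.inter_comm (hits ends t u w), ← Set.inter_assoc]
    rw [e] at key
    exact key
  -- the splits `YR = YHR + YA`, `ZR = ZHR + ZA`, `a = HR + A`
  have sY : YR = YHR + YA := prob_inter_RT_split p ends s t u w (connEvent ends s b)
  have sZ : ZR = ZHR + ZA := prob_inter_RT_split p ends s t u w (connEvent ends t v)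
  have sa : a = HR + A := by
    have := prob_inter_RT_split p ends s t u w Set.univ
    simp only [Set.univ_inter] at this
    rw [Set.inter_comm] at this
    exact this
  -- the two shifts
  have shY : 0 ≤ a * YA - A * YR := by
    have : a * YA - A * YR = YR * HR - YHR * a := by rw [sY, sa]; ring
    rw [this]; linarith
  have shZ : a * ZA - A * ZR ≤ 0 := by
    have : a * ZA - A * ZR = ZR * HR - ZHR * a := by rw [sZ, sa]; ring
    rw [this]; linarith
  -- nonnegativity and the bounds by `A`
  have hA0 : 0 ≤ A := prob_nonneg hp _
  have ha0 : 0 ≤ a := prob_nonneg hp _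
  have hYZA_le : YZA ≤ A := prob_inter_le_right hp _ _
  have hYA_le : YA ≤ A := prob_inter_le_right hp _ _
  have hZA_le : ZA ≤ A := prob_inter_le_right hp _ _
  have hYZA0 : 0 ≤ YZA := prob_nonneg hp _
  have hYA0 : 0 ≤ YA := prob_nonneg hp _
  have hZA0 : 0 ≤ ZA := prob_nonneg hp _
  have hYR0 : 0 ≤ YR := prob_nonneg hp _
  have hZR0 : 0 ≤ ZR := prob_nonneg hp _
  -- the identity `A · sector0 = (a·YA − A·YR)(a·ZA − A·ZR) + a²(A·YZA − YA·ZA)`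
  have hid : A * (a ^ 2 * YZA - a * YR * ZA - a * ZR * YA + YR * ZR * A) =
      (a * YA - A * YR) * (a * ZA - A * ZR) + a ^ 2 * (A * YZA - YA * ZA) := by
    ring
  have hAL : A * (a ^ 2 * YZA - a * YR * ZA - a * ZR * YA + YR * ZR * A) ≤ 0 := by
    rw [hid]
    have h1 : (a * YA - A * YR) * (a * ZA - A * ZR) ≤ 0 := mul_nonpos_of_nonneg_of_nonpos shY shZ
    have h2 : a ^ 2 * (A * YZA - YA * ZA) ≤ 0 := by
      apply mul_nonpos_of_nonneg_of_nonpos (sq_nonneg a)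
      linarith [hi]
    linarith
  rcases hA0.lt_or_eq with hApos | hAzero
  · exact le_of_mul_le_mul_left (by rw [mul_zero]; exact hAL) hApos
  · -- `A = 0` forces the three sector-0 masses to vanish
    rw [← hAzero] at hYZA_le hYA_le hZA_le
    have e1 : YZA = 0 := le_antisymm hYZA_le hYZA0
    have e2 : YA = 0 := le_antisymm hYA_le hYA0
    have e3 : ZA = 0 := le_antisymm hZA_le hZA0
    rw [e1, e2, e3, ← hAzero]
    simp

end Sector0

/-! ## The reduction -/

section Reduction

/-- **(MM0⁻) from (S1)**: if the sector-1 part is nonpositive, `mm0minusForm ≤ 0`. -/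
theorem mm0minus_of_sector1 (p : E → R) (hp : IsProbVec p) (ends : E → Sym2 V) (s t b u w v : V)
    (h1 : sector1Form p ends s t b u w v ≤ 0) :
    mm0minusForm p ends s t b u w v ≤ 0 := by
  rw [mm0minusForm_eq]
  linarith [sector0_nonpos p hp ends s t b u w v]

end Reduction

end MM0Sector
end Summit.Ventures.PercRepro2
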